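import Literature.Probability.Percolation.IntExit
import Literature.Probability.Percolation.AdjDihedral
import Literature.Probability.Percolation.ArmSeparationInMoveFour
import HarnessLib

/-!
# The inner landing move in rotated frames: the spoke into `Λ_m` and the hook of an inner exit

Topic `Literature/Probability/Percolation`; family `crit-perc` / near-critical percolation on `𝕋`.
A brick of the INNER half of the near-critical arm-separation theorem for four arms in the ADJACENT
colour arrangement (P. Nolin, EJP 13 (2008), Thm. 11, `j = 4`, `σ = BBWW` [arXiv 0711.4948:
Thm. 10], §4.3 Prop. 12 and §4.4, internal extremities). The rotation-frame counterpart of the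
hook of `ArmSeparationSpoke.arm_to_entry` for the inner EXITS of the pair surgery (`IntExit`, tip
side read through `ρ^i`), without beacon: the spoke is the thin horizontal tube
`[m-k-L, m-k] × [T₀+w+k+k/4, T₀+w+k+k/4+2ε]` running from the corner box of the exit INTO `Λ_m`,
so that its horizontal crossing meets the vertical corner crossing of the exit directly (as in the
outer `trapExit_to_entry`):

* `inSpokeTube m k T₀ w L ε`, `inSpokeEvent i m k T₀ w L ε` (+ `isUpperSet_`, `determinedBy_`,
  `real_inSpokeEvent`);
* `intExit_to_entry` — from the far end `ρ^i F.b` of the exit to the start of the crossing of an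
  entry tube `E` of the original frame meeting the spoke (`SpokeMeetsRot i`, `spoke_junctionRot`),
  inside `ρ^i(spoke box ∪ region ∪ exit zone ∪ corner box) ∪ E.box`;
* `int_hook_norm` — norms of the sites of the hook pieces;
* `sepOpenArm_of_intExit` — the inner landing move of an exit (outer end on the same side read in
  the original frame): `χ ∈ sepOpenArm n N`, by `landing_glue_gen` with `q = 0`.

Everything here is proved; no named facts are introduced.

## References

* P. Nolin, Near-critical percolation in two dimensions, *Electron. J. Probab.* 13 (2008), §4.3
  Prop. 12 (proof) and §4.4, internal extremities (arXiv 0711.4948: Prop. 11, Thm. 10) [Nolin2008].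
-/

noncomputable section

open Set MeasureTheory

namespace Literature.Probability.Percolation

open LatticeModels Tube HalfAnnulus

/-! ### The spoke into `Λ_m` -/

/-- **The inner spoke of the window `[T₀, T₀+w)` at scale `k`** (tip's frame): the thin horizontal
tube `[m-k-L, m-k] × [T₀+w+k+k/4, T₀+w+k+k/4+2ε]` from the right column of the corner box
inwards. [cite: Nolin2008, §4.3 Prop. 12 (proof), internal extremities (arXiv 0711.4948: Prop. 11)] -/
def inSpokeTube (m k : ℕ) (T₀ : ℤ) (w L ε : ℕ) : Tube :=
  ⟨(m : ℤ) - k - L, T₀ + w + k + (k / 4 : ℕ), L, 2 * ε, true⟩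

/-- **The inner spoke is crossed** (an event of the original configuration, read in the rotated
frame `i`). [cite: Nolin2008, §4.3 Prop. 12 (proof), internal extremities (arXiv 0711.4948: Prop. 11)] -/
def inSpokeEvent (i m k : ℕ) (T₀ : ℤ) (w L ε : ℕ) : Set (SiteConfig (Site 2)) :=
  rotConfig i ⁻¹' (inSpokeTube m k T₀ w L ε).event

/-- The inner spoke event is increasing. [folklore] -/
theorem isUpperSet_inSpokeEvent (i m k : ℕ) (T₀ : ℤ) (w L ε : ℕ) : IsUpperSet (inSpokeEvent i m k T₀ w L ε) :=
  isUpperSet_preimage_rotConfig i (inSpokeTube m k T₀ w L ε).isUpperSet_event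

/-- The inner spoke event is determined by the rotated image of the spoke's box. [folklore] -/
theorem determinedBy_inSpokeEvent (i m k : ℕ) (T₀ : ℤ) (w L ε : ℕ) :
    DeterminedBy (inSpokeEvent i m k T₀ w L ε) (triRotIsoPow i '' (inSpokeTube m k T₀ w L ε).box) := by
  have h := determinedBy_preimage_rotConfig i (inSpokeTube m k T₀ w L ε).determinedBy_event
  rwa [coe_sites] at h

/-- The probability of the inner spoke event is that of crossing the spoke tube. [folklore] -/
theorem real_inSpokeEvent (p : unitInterval) (i m k : ℕ) (T₀ : ℤ) (w L ε : ℕ) :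
    (triSitePercolation p).real (inSpokeEvent i m k T₀ w L ε) = (triSitePercolation p).real (inSpokeTube m k T₀ w L ε).event :=
  real_preimage_rotConfig p i _

/-! ### The hook -/

/-- **From the inner exit to the entry tube.** Let `F` be an inner exit of `rotConfig i ω`
(region `A`), its tip row in the window `[T₀, T₀+w)`, the inner spoke crossed (`inSpokeEvent i`),
and `E` a tube of the original frame crossed from `xE` to `yE` with `SpokeMeetsRot i`. Then
`ρ^i F.b` is joined to `xE` by an open path of
`ρ^i(spoke box ∪ A ∪ exit zone ∪ corner box) ∪ E.box`. [cite: Nolin2008, §4.3 Prop. 12 (proof) and §4.4, internal extremities (arXiv 0711.4948: Prop. 11, Thm. 10)] -/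
theorem intExit_to_entry {m k₀ K : ℕ} {A : Set (Site 2)} {i : ℕ} (hi : i < 6) {ω : SiteConfig (Site 2)}
    (F : IntExit m A k₀ K (rotConfig i ω)) {T₀ : ℤ} {w : ℕ} (hwin : T₀ ≤ F.z 1 ∧ F.z 1 < T₀ + w)
    {L ε : ℕ} (hfit : (w : ℤ) + (F.k / 4 : ℕ) + 2 * ε ≤ F.k) (hL : F.k + 1 ≤ L)
    (hSp : ω ∈ inSpokeEvent i m F.k T₀ w L ε)
    {E : Tube} {xE yE : Site 2} (hE : E.IsCrossing ω xE yE) (hJ : SpokeMeetsRot i (inSpokeTube m F.k T₀ w L ε) E) :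
    PathIn triGraph ((triRotIsoPow i '' ((inSpokeTube m F.k T₀ w L ε).box ∪
        (A ∪ intExitZone m F.z F.k ∪ triStrip (F.z 0 - 2 * F.k) (F.z 1 + F.k) F.k F.k)) ∪ E.box) ∩ ω)
      (triRotIsoPow i F.b) xE := by
  obtain ⟨Sp, hSp'⟩ : ∃ Sp : Tube, Sp = inSpokeTube m F.k T₀ w L ε := ⟨_, rfl⟩
  have hSa : Sp.a = (m : ℤ) - F.k - L := by rw [hSp']; rfl
  have hSb : Sp.b = T₀ + w + F.k + (F.k / 4 : ℕ) := by rw [hSp']; rfl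
  have hSw : Sp.w = L := by rw [hSp']; rfl
  have hSh : Sp.h = 2 * ε := by rw [hSp']; rfl
  have hShz : Sp.horiz = true := by rw [hSp']; rfl
  have hSp2 : rotConfig i ω ∈ Sp.event := by rw [hSp']; exact hSp
  rw [← hSp'] at hJ ⊢
  obtain ⟨hz0, hz1, hz1'⟩ := F.z_isIntJ
  have hL' : (F.k : ℤ) + 1 ≤ L := by exact_mod_cast hL
  -- (1) the crossing of the spoke in the frame
  obtain ⟨x', y', hcr⟩ := Sp.exists_isCrossing hSp2
  have hs' : x' 0 = Sp.a ∧ y' 0 = Sp.a + Sp.w := by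
    have hs := hcr.1
    rw [hShz] at hs
    simpa using hs
  have P' := hcr.2
  obtain ⟨SH, hSH, PH, TH⟩ := P'.exists_support
  have hSHb : ∀ v ∈ SH, Sp.a ≤ v 0 ∧ v 0 ≤ Sp.a + Sp.w ∧ Sp.b ≤ v 1 ∧ v 1 ≤ Sp.b + Sp.h := fun v hv =>
    (Tube.mem_box Sp).1 (hSH hv).1
  -- (2) the corner crossing catches the spoke (frame coordinates)
  obtain ⟨b, t, hb1, ht1, Pb, Pt⟩ := F.vcross
  obtain ⟨S₁, hS₁, PS₁, TS₁⟩ := Pb.symm.exists_support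
  obtain ⟨S₂, hS₂, PS₂, TS₂⟩ := Pt.exists_support
  have PV : PathIn triGraph (S₁ ∪ S₂) b t := (PS₁.symm.mono subset_union_left).trans (PS₂.mono subset_union_right)
  have hSVb : ∀ v ∈ S₁ ∪ S₂, F.z 0 - 2 * F.k ≤ v 0 ∧ v 0 ≤ F.z 0 - 2 * F.k + F.k ∧ F.z 1 + F.k ≤ v 1 ∧ v 1 ≤ F.z 1 + F.k + F.k := by
    rintro v (hv | hv)
    · exact (mem_triStrip.1 (hS₁ hv).1)
    · exact (mem_triStrip.1 (hS₂ hv).1)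
  have hk : ((trapScale k₀ F.j : ℕ) : ℤ) = F.k := rfl
  obtain ⟨u, huH, huV⟩ := exists_mem_of_cross (L := F.z 0 - 2 * F.k) (R := F.z 0 - F.k) (B := F.z 1 + F.k) (T := F.z 1 + 2 * F.k)
    (by omega) (by omega) PH (by rw [hs'.1, hSa]; omega) (by rw [hs'.2, hSa, hSw]; omega)
    (fun v hv _ _ => by have := hSHb v hv; omega)
    PV (by rw [hk] at hb1; omega) (by rw [hk] at ht1; omega) (fun v hv _ _ => by have := hSVb v hv; omega)
  -- from `m'` to `u` inside the corner box, then along the spoke to its inner end `x'`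
  have Pmu : PathIn triGraph (triStrip (F.z 0 - 2 * F.k) (F.z 1 + F.k) F.k F.k ∩ rotConfig i ω) F.m' u := by
    rcases huV with hu | hu
    · exact (TS₁ u hu).mono hS₁
    · exact (TS₂ u hu).mono hS₂
  have Pux : PathIn triGraph (Sp.box ∩ rotConfig i ω) u x' := (TH u huH).symm.mono hSH
  have Pframe : PathIn triGraph ((Sp.box ∪ (A ∪ intExitZone m F.z F.k ∪ triStrip (F.z 0 - 2 * F.k) (F.z 1 + F.k) F.k F.k)) ∩ rotConfig i ω) F.b x' := by
    refine ((F.path.mono ?_).trans (Pmu.mono ?_)).trans (Pux.mono ?_)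
    · rintro v ⟨hv, hvχ⟩; exact ⟨Or.inr (Or.inl hv), hvχ⟩
    · rintro v ⟨hv, hvχ⟩; exact ⟨Or.inr (Or.inr hv), hvχ⟩
    · rintro v ⟨hv, hvχ⟩; exact ⟨Or.inl hv, hvχ⟩
  -- (3) read in the original frame, then the junction with `E`
  have Pphys := pathIn_of_rotConfig_open i Pframe
  have Q := spoke_junctionRot hi hShz hcr hE hJ
  refine PathIn.trans (Pphys.mono fun v hv => ⟨Or.inl hv.1, hv.2⟩) (Q.mono ?_)
  rintro v ⟨hv | hv, hvω⟩
  · obtain ⟨q, hq, rfl⟩ := hv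
    exact ⟨Or.inl ⟨q, Or.inl hq, rfl⟩, hvω⟩
  · exact ⟨Or.inr hv, hvω⟩

/-- **Norms of the hook pieces**: the spoke box, the exit zone and the corner box of a middle tip
(`-m + R₀ ≤ z₁ ≤ -R₀`, `R₀ ≥ 8k + 2`, window below the tip row with the fit) lie in
`{m - k - L - … ≤ |v| < m + 6k + 2}`; precisely `m - k - L ≤ |v|` and `|v| ≤ m + 6k + 1`. [folklore] -/
theorem int_hook_norm {m k : ℕ} {z : Site 2} (hz : IsIntJ m z) {R₀ : ℕ} (hmid : -(m : ℤ) + R₀ ≤ z 1 ∧ z 1 ≤ -(R₀ : ℤ))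
    (hR : 8 * k + 2 ≤ R₀) {T₀ : ℤ} {w L ε : ℕ} (hwin : T₀ ≤ z 1 ∧ z 1 < T₀ + w) (hfit : (w : ℤ) + (k / 4 : ℕ) + 2 * ε ≤ k)
    (hL : (k : ℤ) + 1 ≤ L) (hLm : (k : ℤ) + L + R₀ ≤ m) {v : Site 2}
    (hv : v ∈ (inSpokeTube m k T₀ w L ε).box ∪ (intExitZone m z k ∪ triStrip (z 0 - 2 * k) (z 1 + k) k k)) :
    (m : ℤ) - k - L ≤ triNorm v ∧ triNorm v ≤ (m : ℤ) + 6 * k + 1 := by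
  obtain ⟨hz0, hz1, hz2⟩ := hz
  have hR' : 8 * (k : ℤ) + 2 ≤ R₀ := by exact_mod_cast hR
  have hk4 : 4 * ((k / 4 : ℕ) : ℤ) ≤ k := by omega
  rcases hv with hv | hv | hv
  · rw [Tube.mem_box] at hv
    simp only [inSpokeTube] at hv
    push_cast at hv
    exact ⟨le_triNorm_iff_lin.2 (Or.inl (by omega)), triNorm_le_iff_lin.2 (by omega)⟩
  · rw [mem_intExitZone] at hv
    obtain ⟨-, h1, h2, h3, h4⟩ := hv
    have hk0 : (0 : ℤ) ≤ k := by positivity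
    exact ⟨le_triNorm_iff_lin.2 (Or.inl (by omega)), triNorm_le_iff_lin.2 (by omega)⟩
  · rw [mem_triStrip] at hv
    exact ⟨le_triNorm_iff_lin.2 (Or.inl (by omega)), triNorm_le_iff_lin.2 (by omega)⟩

/-! ### The inner landing move of an exit, in rotated frames -/

/-- **The inner landing move of an inner exit** (rotation frames; outer end on the side `0`). Let
`F` be an inner exit at `∂Λ_m` of `rotConfig i χ` (`i < 6`), region `A` with
`ρ^i '' A ⊆ annulus(n, N) ∪ outer landing ball`, far end `(ρ^i)⁻¹ uo` where `uo` is the attaching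
site of the outer free space of `χ` at `zo ∈ sepLanding N`; tip row in the window `[T₀, T₀ + w)`;
the inner spoke crossed; an arc of the thin ring of radius `r` crossed, containing a tube met by the
spoke (`SpokeMeetsRot i`) and the run `V_{j₀}, …, V_{j₀+d}` across the rows `[t, t + n/64]`; the
approach tube and the thinned target free space at a middle target row `t` crossed; size
conditions. Then `χ ∈ sepOpenArm n N` (`landing_glue_gen` with `q = 0`). [cite: Nolin2008, §4.3 Prop. 12 and §4.4, internal extremities (arXiv 0711.4948: Prop. 11, Thm. 10, p. 13)] -/
theorem sepOpenArm_of_intExit {m n N k₀ K : ℕ} {i : ℕ} (hi : i < 6) {χ : SiteConfig (Site 2)} {zo uo : Site 2}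
    (hzo : zo ∈ sepLanding N)
    (hOut : OpenVCrossThrough (sepOuterFence N zo) (zo 1 - (N / 64 : ℕ)) (zo 1 + (N / 64 : ℕ)) χ uo)
    {A : Set (Site 2)} (hA : triRotIsoPow i '' A ⊆ triAnnulusSet n N ∪ triOpenBall zo (N / 8))
    (F : IntExit m A k₀ K (rotConfig i χ)) (hb : triRotIsoPow i F.b = uo)
    {R₀ : ℕ} (hmid : -(m : ℤ) + R₀ ≤ F.z 1 ∧ F.z 1 ≤ -(R₀ : ℤ)) (hR : 8 * F.k + 2 ≤ R₀)
    {T₀ : ℤ} {w : ℕ} (hwin : T₀ ≤ F.z 1 ∧ F.z 1 < T₀ + w)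
    {L ε : ℕ} (hfit : (w : ℤ) + (F.k / 4 : ℕ) + 2 * ε ≤ F.k) (hL : F.k + 1 ≤ L) (hSp : χ ∈ inSpokeEvent i m F.k T₀ w L ε)
    {r e s a len : ℕ} (hs : 1 ≤ s) (hsr : s ∣ r) (hsr' : s ≤ r) (he : 2 * e ≤ r)
    (harc : χ ∈ eventAll (arc (thinRing r e s) a len))
    {Te : Tube} (hTe : Te ∈ arc (thinRing r e s) a len) (hJ : SpokeMeetsRot i (inSpokeTube m F.k T₀ w L ε) Te)
    {t : ℤ} (ht : -(n : ℤ) + (n / 4 : ℕ) + (n / 16 : ℕ) ≤ t ∧ t ≤ -((n / 4 : ℕ) : ℤ) - (n / 16 : ℕ))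
    {j₀ d : ℕ} (hSL : ∀ T ∈ vchunks r (-(r : ℤ)) e s j₀ (d + 1), T ∈ arc (thinRing r e s) a len)
    (hlo : -(r : ℤ) + j₀ * s - e ≤ t) (hhi : t + (n / 64 : ℕ) ≤ -(r : ℤ) + (j₀ + d) * s - e)
    {W : ℕ} (hW : (n : ℤ) - (n / 8 : ℕ) + 1 + W = r + 2 * e) (hH : χ ∈ tgtH n t W) (hV : χ ∈ tgtV n t)
    (hn : 64 ≤ n) (hnr : (n : ℤ) + s + 2 * e ≤ r) (hrm : (r : ℤ) + 2 * e ≤ (m : ℤ) - F.k - L) (hLm : (F.k : ℤ) + L + R₀ ≤ m)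
    (hmN : (m : ℤ) + 6 * F.k + 1 ≤ N) :
    χ ∈ sepOpenArm n N := by
  rw [← sepArmGen_zero]
  have hland := inTgtRow_mem_sepLanding ht
  -- the arc as a nonempty chain with prescribed crossings
  obtain ⟨E, L', hEL⟩ := List.exists_cons_of_ne_nil (List.ne_nil_of_mem hTe)
  have harc' : ∀ T ∈ E :: L', χ ∈ T.event := fun T hT => harc T (hEL ▸ hT)
  have hch : List.IsChain Crosses (E :: L') := hEL ▸ isChain_arc_thinRing hs hsr hsr' a len
  obtain ⟨X, Y, hXY⟩ := exists_crossings harc'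
  have hTe' : Te ∈ E :: L' := hEL ▸ hTe
  have hring : ∀ T ∈ E :: L', T ∈ thinRing r e s := fun T hT => mem_of_mem_arc (hEL ▸ hT : T ∈ arc (thinRing r e s) a len)
  have hLreg : ∀ T ∈ E :: L', T.box ⊆ triAnnulusSet n N := fun T hT v hv => by
    have := triNorm_mem_of_mem_thinRing he (hring T hT) hv
    rw [mem_triAnnulusSet]; constructor <;> omega
  -- the hook
  have P₁ := intExit_to_entry hi F hwin hfit hL hSp (hXY Te hTe') hJ
  rw [hb] at P₁
  -- everything lies in the arm region
  have hreg : (triRotIsoPow i '' ((inSpokeTube m F.k T₀ w L ε).box ∪ (A ∪ intExitZone m F.z F.k ∪ triStrip (F.z 0 - 2 * F.k) (F.z 1 + F.k) F.k F.k)) ∪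
      Te.box) ⊆ genRegion n N 0 zo ![(n : ℤ), t] := by
    have hann : ∀ v : Site 2, (n : ℤ) ≤ triNorm v → triNorm v ≤ N → v ∈ genRegion n N 0 zo ![(n : ℤ), t] :=
      fun v h1 h2 => Or.inl (Or.inl ⟨h1, h2⟩)
    have hpieces : ∀ u ∈ (inSpokeTube m F.k T₀ w L ε).box ∪ (intExitZone m F.z F.k ∪ triStrip (F.z 0 - 2 * F.k) (F.z 1 + F.k) F.k F.k),
        triRotIsoPow i u ∈ genRegion n N 0 zo ![(n : ℤ), t] := fun u hu => by
      have hb := int_hook_norm F.z_isIntJ hmid hR hwin hfit (by exact_mod_cast hL) hLm hu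
      exact hann _ (by rw [triNorm_rot]; omega) (by rw [triNorm_rot]; omega)
    rintro v (⟨u, hu, rfl⟩ | hv)
    · rcases hu with hu | (hu | hu) | hu
      · exact hpieces u (Or.inl hu)
      · rcases hA ⟨u, hu, rfl⟩ with h | h
        · exact Or.inl (Or.inl h)
        · refine Or.inl (Or.inr ?_)
          exact ⟨triRotIsoPow i u, h, rfl⟩
      · exact hpieces u (Or.inr (Or.inl hu))
      · exact hpieces u (Or.inr (Or.inr hu))
    · have := hLreg Te hTe' hv
      rw [mem_triAnnulusSet] at this
      exact hann v this.1 this.2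
  -- glue (`q = 0`: the outer free space of `χ` itself)
  have hOut' : OpenVCrossThrough (sepOuterFence N zo) (zo 1 - (N / 64 : ℕ)) (zo 1 + (N / 64 : ℕ)) (frameConfig 0 χ) uo := by
    have h0 : frameConfig 0 χ = χ := by ext v; rw [mem_frameConfig]; rfl
    rw [h0]; exact hOut
  have P₁' : PathIn triGraph ((triRotIsoPow i '' ((inSpokeTube m F.k T₀ w L ε).box ∪
      (A ∪ intExitZone m F.z F.k ∪ triStrip (F.z 0 - 2 * F.k) (F.z 1 + F.k) F.k F.k)) ∪ Te.box) ∩ χ) (frameIso 0 uo) (X Te) := by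
    have h0 : (frameIso 0 uo : Site 2) = uo := rfl
    rw [h0]; exact P₁
  exact landing_glue_gen hzo hOut' hland hch hXY hLreg hreg hTe' P₁' (fun T hT => hEL ▸ hSL T hT) hlo hhi (by omega) hW hH hV hn (by omega)

end Literature.Probability.Percolation
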